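import Literature.Computability.Complexity.KeyImplication
import Literature.Computability.Complexity.ReductionData
import Literature.Computability.Complexity.ApproxDensity
import Literature.Computability.Complexity.SoundnessCounting
import HarnessLib

/-!
# Hirahara's reduction: the soundness count assembled

Topic `Computability/Complexity`. The soundness half of Hirahara's Lemma 8.3 / Thm. 8.5 for `MCSP*`
(ECCC TR22-119, pp. 28–31) as ONE counting statement about the coins `F = (f_k)_{k < n}` of the
reduction, `f_k : {0,1}^{N_k} → {0,1}` uniform and independent, with the padded amplified functions
`f̂_k(y) = Amp^{f_k}((Φ_k⁻¹ y).1)` feeding the sample of `KeyImplication.lean`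
(`HiraharaRed.point`, `HiraharaRed.Cons`): for a finite family `𝒢` of tests,

  `#{F | ∃ g ∈ 𝒢, g consistent with the sample of F} · 2^m ≤ |𝒢| · 2ⁿ · ∏_k 2^{2^{N_k}}`

(`HiraharaRed.card_cons_mul_le`), under: the NO-promise in the abstract form "every set of variables
authorized for all formulas has weight `> W₀`", the parameter inequalities of the amplification
(`k_A η ≥ 24`, `C η ≥ 8 k_A`, `η mm Δ < 1/2`) and of the density bits `c_k`
(`2^{c_k} · |Par_k| · |Suf_k| · (C²+1) · |Adv_k|^{C²} · 4^{2^{N_k}} ≤ 2^{2^{N_k}} · 3^{2^{N_k} - 2^{N_k}/4}`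
whenever `c_k ≠ 0`), and `m ≤ ∑_{k ∈ S} c_k` for every heavy `S`. It is the composition of
`HiraharaRed.authorized_of_cons` (key implication), `ApproxDensity.card_filter_approx_mul_le`
(density) and `SoundnessCounting.card_filter_exists_consistent_mul_le` (union bound).

## References

* S. Hirahara, *NP-hardness of learning programs and partial MCSP*, ECCC TR22-119, proof of
  Lemma 8.3 (soundness) and of Thm. 8.5 (pp. 28–31) [Hirahara2022PartialMCSP].
-/

namespace Literature.Computability.Complexity

open Finset
open Literature.Computability.MetaComplexity (MonotoneDNF)
open Literature.Computability.MetaComplexity.MonotoneDNF (BenalohLeichter.Rand)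

namespace HiraharaRed

open scoped Classical

variable {n Δ ν ℓ dNW mm kA : ℕ}

variable (A : AmpData n ℓ kA) (E : Fin n × Fin Δ → (Fin ℓ ↪ Fin dNW)) (φ : Fin ν → MonotoneDNF)
  (slot : Fin ν → Fin mm → Option (Fin n))

/-- The per-variable approximability predicate `Q g k f`: `f̂` is `η`-approximable at some position
`(k,t)` from some test of `g`. [cite: Hirahara2022PartialMCSP, proof of Lemma 8.3 (i ∈ B)] -/
def Qpred (η : ℝ) (g : X ν dNW mm Δ → Bool) (k : Fin n) (f : (Fin (A.N k) → Bool) → Bool) : Prop :=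
  ∃ (j : Fin ν) (b : Bool) (r : BenalohLeichter.Rand (φ j)) (t : Fin Δ),
    NWExtract.Approx (E := E) (test φ slot g j b r) η (k, t) (fhat A k f)

/-- The parameters of the centres for variable `k`: `(j, b, r, t, a)`. [cite: Hirahara2022PartialMCSP, proof of Lemma 8.3 (advice of Lemma 6.6)] -/
abbrev Par (k : Fin n) : Type :=
  Σ j : Fin ν, Bool × BenalohLeichter.Rand (φ j) × Σ t : Fin Δ, NWExtract.Adv E (k, t)

/-- The advice of Lemma 6.6 at a position is a finite type. [folklore] -/
noncomputable instance instFintypeAdv (p : Fin n × Fin Δ) : Fintype (NWExtract.Adv E p) := by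
  unfold NWExtract.Adv; infer_instance

/-- The centre parameters form a finite type. [folklore] -/
noncomputable instance instFintypePar (k : Fin n) : Fintype (Par E φ k) := by
  unfold Par; infer_instance

variable {A E φ slot}

/-- `B(g)` of the key implication is the set of `Q`-variables. [folklore] -/
theorem Bset_eq (η : ℝ) (g : X ν dNW mm Δ → Bool) (F : Coins A) :
    Bset E (Fhat A F) φ slot g η = univ.filter fun k => Qpred A E φ slot η g k (F k) := by
  ext k
  simp only [Bset, Qpred, Fhat, mem_filter, mem_univ, true_and]

/-- **Density of `Q`** from `ApproxDensity.card_filter_approx_mul_le`. [cite: Hirahara2022PartialMCSP, Lemma 8.1 and proof of Lemma 8.3 (p. 29)] -/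
theorem card_Q_mul_le [NeZero kA] (hidx : ∀ k, Function.Injective (A.idxA k)) {η : ℝ} (hη : 0 < η)
    (hkη : 24 ≤ kA * η) {C : ℕ} (hCη : 8 * kA ≤ C * η) (g : X ν dNW mm Δ → Bool) (k : Fin n) :
    ((univ : Finset ((Fin (A.N k) → Bool) → Bool)).filter (Qpred A E φ slot η g k)).card *
        3 ^ (2 ^ A.N k - 2 ^ A.N k / 4) ≤
      Fintype.card (Par E φ k) * Fintype.card (A.Suf k) * (C ^ 2 + 1) *
        Fintype.card (IWAmp.Adv (A.eA k) (m := A.mI k)) ^ (C ^ 2) * 4 ^ (2 ^ A.N k) := by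
  -- the candidate functions
  set G : Par E φ k → (Fin ℓ → Bool) → Bool := fun p =>
    NWExtract.recon (E := E) (test φ slot g p.1 p.2.1 p.2.2.1) (k, p.2.2.2.1) p.2.2.2.2 with hG
  have h := ApproxDensity.card_filter_approx_mul_le (e := A.eA k) (idx := A.idxA k) (hidx k) hη hkη hCη
    (A.Φ k) G
  refine le_trans (Nat.mul_le_mul_right _ (card_le_card fun f hf => ?_)) h
  rw [mem_filter] at hf ⊢
  refine ⟨mem_univ _, ?_⟩
  obtain ⟨j, b, r, t, a, ha⟩ := hf.2
  exact ⟨⟨j, b, r, t, a⟩, ha⟩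

/-- **Soundness of Hirahara's reduction, counting form.** [cite: Hirahara2022PartialMCSP, proof of Lemma 8.3 (soundness) and of Thm. 8.5 (pp. 28–31)] -/
theorem card_cons_mul_le [NeZero kA] (hidx : ∀ k, Function.Injective (A.idxA k)) {η : ℝ} (hη : 0 < η)
    (hkη : 24 ≤ kA * η) {C : ℕ} (hCη : 8 * kA ≤ C * η) (hηm : η * (mm * Δ : ℝ) < 1 / 2)
    (𝒢 : Finset (X ν dNW mm Δ → Bool)) (w c : Fin n → ℕ) (W₀ m : ℕ)
    (hNo : ∀ S : Finset (Fin n), (∀ j, S.image Fin.val ∈ (φ j).accessStructure.authorized) → W₀ < ∑ k ∈ S, w k)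
    (hc : ∀ k, c k ≠ 0 → 2 ^ c k * (Fintype.card (Par E φ k) * Fintype.card (A.Suf k) * (C ^ 2 + 1) *
        Fintype.card (IWAmp.Adv (A.eA k) (m := A.mI k)) ^ (C ^ 2)) * 4 ^ (2 ^ A.N k) ≤
        2 ^ (2 ^ A.N k) * 3 ^ (2 ^ A.N k - 2 ^ A.N k / 4))
    (hm : ∀ S : Finset (Fin n), W₀ < ∑ k ∈ S, w k → m ≤ ∑ k ∈ S, c k) :
    ((univ : Finset (Coins A)).filter fun F => ∃ g ∈ 𝒢, Cons E (Fhat A F) φ slot g).card * 2 ^ m ≤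
      𝒢.card * 2 ^ n * Fintype.card (Coins A) := by
  have h := SoundnessCounting.card_filter_exists_consistent_mul_le (K := Fin n)
    (Φ := fun k => (Fin (A.N k) → Bool) → Bool) 𝒢 (fun g F => Cons E (Fhat A F) φ slot g)
    (fun g k f => Qpred A E φ slot η g k f) c w W₀ m ?_ ?_ hm
  · simpa using h
  · -- key implication
    intro g _ F hcons
    have hauth := fun j => authorized_of_cons (E := E) (Fhat := Fhat A F) (φ := φ) (slot := slot) hη.le hηm hcons j
    have := hNo (Bset E (Fhat A F) φ slot g η) hauth
    rwa [Bset_eq] at this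
  · -- density
    intro g _ k
    by_cases hck : c k = 0
    · rw [hck, pow_zero, mul_one]; exact card_filter_le _ _
    have hQ := card_Q_mul_le (A := A) (E := E) (φ := φ) (slot := slot) hidx hη hkη hCη g k
    have hV : Fintype.card ((Fin (A.N k) → Bool) → Bool) = 2 ^ (2 ^ A.N k) := by simp
    rw [hV]
    have h3 : 0 < 3 ^ (2 ^ A.N k - 2 ^ A.N k / 4) := by positivity
    refine Nat.le_of_mul_le_mul_right ?_ h3
    calc ((univ : Finset ((Fin (A.N k) → Bool) → Bool)).filter (Qpred A E φ slot η g k)).card * 2 ^ c k *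
          3 ^ (2 ^ A.N k - 2 ^ A.N k / 4)
        = 2 ^ c k * (((univ : Finset ((Fin (A.N k) → Bool) → Bool)).filter (Qpred A E φ slot η g k)).card *
            3 ^ (2 ^ A.N k - 2 ^ A.N k / 4)) := by ring
      _ ≤ 2 ^ c k * (Fintype.card (Par E φ k) * Fintype.card (A.Suf k) * (C ^ 2 + 1) *
            Fintype.card (IWAmp.Adv (A.eA k) (m := A.mI k)) ^ (C ^ 2) * 4 ^ (2 ^ A.N k)) :=
          Nat.mul_le_mul_left _ hQ
      _ = 2 ^ c k * (Fintype.card (Par E φ k) * Fintype.card (A.Suf k) * (C ^ 2 + 1) *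
            Fintype.card (IWAmp.Adv (A.eA k) (m := A.mI k)) ^ (C ^ 2)) * 4 ^ (2 ^ A.N k) := by ring
      _ ≤ 2 ^ (2 ^ A.N k) * 3 ^ (2 ^ A.N k - 2 ^ A.N k / 4) := hc k hck

end HiraharaRed

end Literature.Computability.Complexity
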